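import Literature.Analysis.SpecialFunctions.HypergeometricConnectionOne
import HarnessLib

/-!
# `₂F₁(a,b;c;−x)` as `x → +∞`: the two-term connection formula DLMF 15.8.2 (resonant case
# included)

Continuation of `HypergeometricConnectionOne.lean` (the connection `0 ↔ 1`, DLMF 15.8.4, on the
segment for `0 < Re b < Re c`, `0 < |c−a−b|`, `|Re(c−a−b)| < 1`) and `HypergeometricPfaff.lean`
(`E(a,b;c;−x) = (1+x)^{−a} E(a, c−b; c; x/(1+x))`). Pfaff sends `x → +∞` to `x/(1+x) → 1⁻` and
turns the parameter `c−a−b` of 15.8.4 into `b − a`; so for Euler's hypergeometric function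
`E = eulerHypergeometric a b c` with `0 < Re b < Re c`, `a ≠ b`, `|Re(b−a)| < 1` and ALL `x > 0`:

  `E(a,b;c;−x) = Γ(c)Γ(b−a)/(Γ(c−a)Γ(b)) · (1+x)^{−a} ₂F₁(a, c−b; a−b+1; 1/(1+x))`
  `            + Γ(c)Γ(a−b)/(Γ(a)Γ(c−b)) · (1+x)^{−b} ₂F₁(c−a, b; b−a+1; 1/(1+x))`

(`eulerHypergeometric_neg_ofReal_connection`) — both series converge for every `x > 0`. This is
DLMF 15.8.2 read through Pfaff: for `x > 1` (and `Re a < Re c`, `Re(c−a), Re(c−b) < 1`, where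
the tree's series-level Pfaff transformation applies) the literal form
`E(a,b;c;−x) = Γ(c)Γ(b−a)/(Γ(b)Γ(c−a)) x^{−a} ₂F₁(a, a−c+1; a−b+1; −1/x)
+ Γ(c)Γ(a−b)/(Γ(a)Γ(c−b)) x^{−b} ₂F₁(b, b−c+1; b−a+1; −1/x)` (`eulerHypergeometric_neg_ofReal_eq_15_8_2`).
The RESONANT case `Re a = Re b`, `a ≠ b` — two terms of equal modulus, e.g. the near-extremal Kerr
cap model `a, b = ½ − i(2ξ − m̂) ∓ iδ`, `c = 1 − 2iξ`, whose amplitudes over the Euler pair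
`x^{−½∓iδ}…` are the two Gamma coefficients — is covered.

* `norm_ordinaryHypergeometric_sub_one_le` — `‖₂F₁(α,β;γ;u) − 1‖ ≤ C‖u‖` on `‖u‖ ≤ ½`
  (`C = Σ‖αₙ₊₁‖2^{−n}`);
* `eulerHypergeometric_neg_ofReal_two_term` — **the two-term asymptotics with error bound**:
  for `x ≥ 1`, `‖E(a,b;c;−x) − (A(1+x)^{−a} + B(1+x)^{−b})‖ ≤ C((1+x)^{−Re a−1} + (1+x)^{−Re b−1})`,
  i.e. `E(a,b;c;−x) = A(1+x)^{−a}(1 + O(1/x)) + B(1+x)^{−b}(1 + O(1/x))`, and the `IsBigO` form;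
* `eulerHypergeometric_neg_ofReal_two_term'` — the same over `x^{−a}, x^{−b}` for `x ≥ 2`:
  `‖E(a,b;c;−x) − (A x^{−a} + B x^{−b})‖ ≤ C(x^{−Re a−1} + x^{−Re b−1})`, via
  `(1+x)^{−p} = x^{−p}(1 + 1/x)^{−p}` and `(1 − w)^{−p} = ₂F₁(p,1;1;w)`
  (`one_sub_cpow_neg_eq_ordinaryHypergeometric`). Here `A = Γ(c)Γ(b−a)/(Γ(c−a)Γ(b))`,
  `B = Γ(c)Γ(a−b)/(Γ(a)Γ(c−b))`; the constants `C` are existential (sums of coefficient series).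

References: NIST DLMF (15.8.2), (15.8.4), (15.8.1) [DLMF]; Andrews–Askey–Roy, *Special Functions*
(1999), Thm 2.3.2, (2.3.12) [AndrewsAskeyRoy1999].
-/

noncomputable section

open Filter Metric Set Complex
open scoped Topology

namespace Literature.Analysis.SpecialFunctions.Hypergeometric

variable {a b c : ℂ}

/-! ### The connection formula on the segment for Euler's function -/

/-- DLMF 15.8.4 for Euler's hypergeometric function `E(a,b;c;x)` (`= ₂F₁` on the segment):
`0 < Re b < Re c`, `c−a−b ≠ 0`, `|Re(c−a−b)| < 1`, `0 < x < 1`. [cite: DLMF, 15.8.4] -/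
theorem eulerHypergeometric_connection_one (hb : 0 < b.re) (hbc : b.re < c.re)
    (hs : c - a - b ≠ 0) (hs1 : (c - a - b).re < 1) (hs2 : -1 < (c - a - b).re) {x : ℝ}
    (hx : x ∈ Ioo (0 : ℝ) 1) :
    eulerHypergeometric a b c x =
      Gamma c * Gamma (c - a - b) / (Gamma (c - a) * Gamma (c - b)) *
          ₂F₁ a b (a + b - c + 1) (1 - (x : ℂ)) +
        Gamma c * Gamma (a + b - c) / (Gamma a * Gamma b) *
          ((1 - (x : ℂ)) ^ (c - a - b) * ₂F₁ (c - a) (c - b) (c - a - b + 1) (1 - (x : ℂ))) := by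
  rw [eulerHypergeometric_eq_ordinaryHypergeometric a hb hbc (norm_ofReal_lt_one_of_mem_Ioo hx)]
  exact ordinaryHypergeometric_connection_one hb hbc hs hs1 hs2 hx

/-! ### DLMF 15.8.2 on the negative axis -/

/-- **The two-term connection of `E(a,b;c;−x)` at `x → +∞`, `(1+x)`-form** (DLMF 15.8.2 via
Pfaff + 15.8.4): for `0 < Re b < Re c`, `b − a ≠ 0`, `|Re(b−a)| < 1` and every `x > 0`,
`E(a,b;c;−x) = Γ(c)Γ(b−a)/(Γ(c−a)Γ(b))·(1+x)^{−a}₂F₁(a,c−b;a−b+1;1/(1+x))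
+ Γ(c)Γ(a−b)/(Γ(a)Γ(c−b))·(1+x)^{−b}₂F₁(c−a,b;b−a+1;1/(1+x))`. [cite: DLMF, 15.8.2] -/
theorem eulerHypergeometric_neg_ofReal_connection (hb : 0 < b.re) (hbc : b.re < c.re)
    (hab : b - a ≠ 0) (h1 : (b - a).re < 1) (h2 : -1 < (b - a).re) {x : ℝ} (hx : 0 < x) :
    eulerHypergeometric a b c (-(x : ℂ)) =
      Gamma c * Gamma (b - a) / (Gamma (c - a) * Gamma b) *
          ((1 + (x : ℂ)) ^ (-a) * ₂F₁ a (c - b) (a - b + 1) (((1 + x)⁻¹ : ℝ) : ℂ)) +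
        Gamma c * Gamma (a - b) / (Gamma a * Gamma (c - b)) *
          ((1 + (x : ℂ)) ^ (-b) * ₂F₁ (c - a) b (b - a + 1) (((1 + x)⁻¹ : ℝ) : ℂ)) := by
  have hcb : 0 < (c - b).re := by simp; linarith
  have hcbc : (c - b).re < c.re := by simp; linarith
  have hx1 : (0 : ℝ) < 1 + x := by linarith
  have hne : (1 : ℂ) + x ≠ 0 := by exact_mod_cast hx1.ne'
  set z : ℝ := x / (1 + x) with hz
  have hz01 : z ∈ Ioo (0 : ℝ) 1 := ⟨div_pos hx hx1, (div_lt_one hx1).2 (by linarith)⟩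
  have hs : c - a - (c - b) = b - a := by ring
  have hconn := eulerHypergeometric_connection_one (a := a) (b := c - b) (c := c) hcb hcbc
    (by rwa [hs]) (by rwa [hs]) (by rwa [hs]) hz01
  rw [hs, show c - (c - b) = b by ring, show a + (c - b) - c = a - b by ring] at hconn
  have hzc : ((z : ℝ) : ℂ) = (x : ℂ) / (1 + x) := by rw [hz]; push_cast; ring
  have h1z : (1 : ℂ) - (z : ℂ) = (((1 + x)⁻¹ : ℝ) : ℂ) := by
    rw [hzc]; push_cast; field_simp; ring
  rw [eulerHypergeometric_neg_ofReal_pfaff a b c (by linarith : (-1 : ℝ) < x), ← hzc, hconn, h1z]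
  have hu : (((1 + x)⁻¹ : ℝ) : ℂ) ^ (b - a) = ((1 + (x : ℂ)) ^ (b - a))⁻¹ := by
    rw [show (((1 + x)⁻¹ : ℝ) : ℂ) = (1 + (x : ℂ))⁻¹ by push_cast; ring]
    exact inv_cpow_of_re_pos (by simp; linarith) _
  have hab' : (1 + (x : ℂ)) ^ (-b) = (1 + (x : ℂ)) ^ (-a) * ((1 + (x : ℂ)) ^ (b - a))⁻¹ := by
    rw [← cpow_neg, ← cpow_add _ _ hne, show -a + -(b - a) = -b by ring]
  rw [hu, hab']
  ring

/-- **DLMF 15.8.2, literal form**, for `x > 1` (so `‖1/x‖ < 1`): under the additional conditions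
`Re a < Re c`, `Re(c−a) < 1`, `Re(c−b) < 1` (where the tree's Pfaff transformation of the series
applies), `E(a,b;c;−x) = Γ(c)Γ(b−a)/(Γ(b)Γ(c−a))·x^{−a}₂F₁(a, a−c+1; a−b+1; −1/x)
+ Γ(c)Γ(a−b)/(Γ(a)Γ(c−b))·x^{−b}₂F₁(b, b−c+1; b−a+1; −1/x)`. [cite: DLMF, 15.8.2] -/
theorem eulerHypergeometric_neg_ofReal_eq_15_8_2 (hb : 0 < b.re) (hbc : b.re < c.re)
    (hac : a.re < c.re) (hca : (c - a).re < 1) (hcb1 : (c - b).re < 1)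
    (hab : b - a ≠ 0) (h1 : (b - a).re < 1) (h2 : -1 < (b - a).re) {x : ℝ} (hx : 1 < x) :
    eulerHypergeometric a b c (-(x : ℂ)) =
      Gamma c * Gamma (b - a) / (Gamma (c - a) * Gamma b) *
          ((x : ℂ) ^ (-a) * ₂F₁ a (a - c + 1) (a - b + 1) (-(x : ℂ)⁻¹)) +
        Gamma c * Gamma (a - b) / (Gamma a * Gamma (c - b)) *
          ((x : ℂ) ^ (-b) * ₂F₁ b (b - c + 1) (b - a + 1) (-(x : ℂ)⁻¹)) := by
  have hx0 : 0 < x := by linarith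
  have hx1 : (0 : ℝ) < 1 + x := by linarith
  have hne : (1 : ℂ) + x ≠ 0 := by exact_mod_cast hx1.ne'
  rw [eulerHypergeometric_neg_ofReal_connection hb hbc hab h1 h2 hx0]
  set u : ℝ := (1 + x)⁻¹ with hu
  have hu0 : 0 < u := inv_pos.2 hx1
  have hun : ‖(u : ℂ)‖ < 1 := by
    rw [norm_real, Real.norm_eq_abs, abs_of_pos hu0, hu, inv_lt_one_iff₀]; right; linarith
  have hure : (u : ℂ).re < 1 / 2 := by
    rw [ofReal_re, hu, ← one_div]; exact one_div_lt_one_div_of_lt two_pos (by linarith)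
  have hquot : (u : ℂ) / ((u : ℂ) - 1) = -(x : ℂ)⁻¹ := by
    have hu0' : (u : ℂ) ≠ 0 := by exact_mod_cast hu0.ne'
    have e : (u : ℂ) - 1 = (u : ℂ) * -(x : ℂ) := by rw [hu]; push_cast; field_simp; ring
    rw [e, ← div_div, div_self hu0', one_div, inv_neg]
  have h1u : ∀ p : ℂ, (1 + (x : ℂ)) ^ p * (1 - (u : ℂ)) ^ p = (x : ℂ) ^ p := by
    intro p
    rw [ofReal_cpow_eq_div_cpow_mul p hx0.le, mul_comm]
    congr 2
    rw [hu]; push_cast; field_simp; ring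
  -- first term: Pfaff in the slot `c − b ↦ (a−b+1) − (c−b) = a − c + 1`; second: symmetry + Pfaff
  have hP1 := ordinaryHypergeometric_pfaff a (b := c - b) (c := a - b + 1) (by simp; linarith)
    (by simp at hca ⊢; linarith) hun hure
  have hsymm : ₂F₁ (c - a) b (b - a + 1) (u : ℂ) = ₂F₁ b (c - a) (b - a + 1) (u : ℂ) := by
    unfold ordinaryHypergeometric; rw [ordinaryHypergeometricSeries_symm]
  have hP2 := ordinaryHypergeometric_pfaff b (b := c - a) (c := b - a + 1) (by simp; linarith)
    (by simp at hcb1 ⊢; linarith) hun hure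
  rw [hP1, hsymm, hP2, hquot, show a - b + 1 - (c - b) = a - c + 1 by ring,
    show b - a + 1 - (c - a) = b - c + 1 by ring, ← mul_assoc ((1 + (x : ℂ)) ^ (-a)),
    ← mul_assoc ((1 + (x : ℂ)) ^ (-b)), h1u, h1u]

/-! ### The series near `0`: `₂F₁(u) = 1 + O(u)` -/

/-- `‖₂F₁(α,β;γ;u) − 1‖ ≤ C‖u‖` for `‖u‖ ≤ ½`, with `C = Σₙ ‖αₙ₊₁‖ 2^{−n} ≥ 0`
(`₂F₁(u) − 1 = Σₙ≥₁ αₙuⁿ`). [cite: DLMF, 15.2.1] -/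
theorem norm_ordinaryHypergeometric_sub_one_le (α β γ : ℂ) :
    ∃ C : ℝ, 0 ≤ C ∧ ∀ u : ℂ, ‖u‖ ≤ 1 / 2 → ‖₂F₁ α β γ u - 1‖ ≤ C * ‖u‖ := by
  set K : ℕ → ℝ := fun n => ‖ordinaryHypergeometricCoefficient α β γ (n + 1)‖ * (1 / 2) ^ n
    with hK
  have hKs : Summable K := by
    have h := (summable_nat_add_iff 1).2
      (summable_norm_coeff_mul_pow α β γ (by norm_num : (0 : ℝ) ≤ 1 / 2) (by norm_num))
    refine (h.mul_left 2).congr fun n => ?_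
    simp only [hK, pow_succ]
    ring
  have hK0 : ∀ n, 0 ≤ K n := fun n => by positivity
  refine ⟨∑' n, K n, tsum_nonneg hK0, fun u hu => ?_⟩
  have hu1 : ‖u‖ < 1 := by linarith
  have h0 := (hasSum_nat_add_iff' 1).2 (hasSum_coeff_mul_pow (a := α) (b := β) (c := γ) hu1)
  simp only [Finset.sum_range_one, pow_zero, mul_one, ordinaryHypergeometricCoefficient,
    Nat.factorial_zero, Nat.cast_one, inv_one, ascPochhammer_zero, Polynomial.eval_one] at h0
  have hle : ∀ n : ℕ, ‖ordinaryHypergeometricCoefficient α β γ (n + 1) * u ^ (n + 1)‖ ≤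
      K n * ‖u‖ := by
    intro n
    simp only [hK]
    rw [norm_mul, norm_pow, pow_succ, ← mul_assoc]
    gcongr
  have hs' : Summable fun n : ℕ => ‖ordinaryHypergeometricCoefficient α β γ (n + 1) * u ^ (n + 1)‖ :=
    .of_nonneg_of_le (fun _ => norm_nonneg _) hle (hKs.mul_right _)
  calc ‖₂F₁ α β γ u - 1‖
      = ‖∑' n : ℕ, ordinaryHypergeometricCoefficient α β γ (n + 1) * u ^ (n + 1)‖ := by
        rw [h0.tsum_eq]
    _ ≤ ∑' n : ℕ, ‖ordinaryHypergeometricCoefficient α β γ (n + 1) * u ^ (n + 1)‖ :=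
        norm_tsum_le_tsum_norm hs'
    _ ≤ ∑' n : ℕ, K n * ‖u‖ := hs'.tsum_le_tsum hle (hKs.mul_right _)
    _ = (∑' n, K n) * ‖u‖ := tsum_mul_right

/-! ### The two-term asymptotics with an error bound -/

/-- `‖(1+x)^{−p}‖ = (1+x)^{−Re p}` for real `x > −1`. [folklore] -/
theorem norm_one_add_ofReal_cpow_neg (p : ℂ) {x : ℝ} (hx : 0 < 1 + x) :
    ‖(1 + (x : ℂ)) ^ (-p)‖ = (1 + x) ^ (-p.re) := by
  rw [show (1 : ℂ) + x = ((1 + x : ℝ) : ℂ) by push_cast; ring, norm_cpow_eq_rpow_re_of_pos hx,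
    neg_re]

/-- **DLMF 15.8.2 as two-term asymptotics with an explicit rate**: for `0 < Re b < Re c`,
`b − a ≠ 0`, `|Re(b−a)| < 1` there is `C` (namely `‖A‖C₃ ⊔ ‖B‖C₄` with the constants of
`norm_ordinaryHypergeometric_sub_one_le`) such that for all `x ≥ 1`,
`‖E(a,b;c;−x) − (A(1+x)^{−a} + B(1+x)^{−b})‖ ≤ C((1+x)^{−Re a−1} + (1+x)^{−Re b−1})`,
`A = Γ(c)Γ(b−a)/(Γ(c−a)Γ(b))`, `B = Γ(c)Γ(a−b)/(Γ(a)Γ(c−b))` — i.e.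
`E(a,b;c;−x) = A(1+x)^{−a}(1 + O(1/x)) + B(1+x)^{−b}(1 + O(1/x))`. [cite: DLMF, 15.8.2] -/
theorem eulerHypergeometric_neg_ofReal_two_term (hb : 0 < b.re) (hbc : b.re < c.re)
    (hab : b - a ≠ 0) (h1 : (b - a).re < 1) (h2 : -1 < (b - a).re) :
    ∃ C : ℝ, 0 ≤ C ∧ ∀ x : ℝ, 1 ≤ x →
      ‖eulerHypergeometric a b c (-(x : ℂ)) -
          (Gamma c * Gamma (b - a) / (Gamma (c - a) * Gamma b) * (1 + (x : ℂ)) ^ (-a) +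
            Gamma c * Gamma (a - b) / (Gamma a * Gamma (c - b)) * (1 + (x : ℂ)) ^ (-b))‖ ≤
        C * ((1 + x) ^ (-a.re - 1) + (1 + x) ^ (-b.re - 1)) := by
  obtain ⟨C₃, hC₃0, hC₃⟩ := norm_ordinaryHypergeometric_sub_one_le a (c - b) (a - b + 1)
  obtain ⟨C₄, hC₄0, hC₄⟩ := norm_ordinaryHypergeometric_sub_one_le (c - a) b (b - a + 1)
  set A : ℂ := Gamma c * Gamma (b - a) / (Gamma (c - a) * Gamma b) with hA
  set B : ℂ := Gamma c * Gamma (a - b) / (Gamma a * Gamma (c - b)) with hB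
  refine ⟨max (‖A‖ * C₃) (‖B‖ * C₄), le_max_of_le_left (by positivity), fun x hx => ?_⟩
  have hx0 : 0 < x := by linarith
  have hx1 : (0 : ℝ) < 1 + x := by linarith
  set u : ℝ := (1 + x)⁻¹ with hu
  have hu0 : 0 < u := inv_pos.2 hx1
  have hunorm : ‖(u : ℂ)‖ = u := by rw [norm_real, Real.norm_eq_abs, abs_of_pos hu0]
  have hu2 : ‖(u : ℂ)‖ ≤ 1 / 2 := by
    rw [hunorm, hu, ← one_div]; exact one_div_le_one_div_of_le two_pos (by linarith)
  have h3 := hC₃ _ hu2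
  have h4 := hC₄ _ hu2
  rw [hunorm] at h3 h4
  rw [eulerHypergeometric_neg_ofReal_connection hb hbc hab h1 h2 hx0]
  have e : A * ((1 + (x : ℂ)) ^ (-a) * ₂F₁ a (c - b) (a - b + 1) (u : ℂ)) +
        B * ((1 + (x : ℂ)) ^ (-b) * ₂F₁ (c - a) b (b - a + 1) (u : ℂ)) -
        (A * (1 + (x : ℂ)) ^ (-a) + B * (1 + (x : ℂ)) ^ (-b)) =
      A * (1 + (x : ℂ)) ^ (-a) * (₂F₁ a (c - b) (a - b + 1) (u : ℂ) - 1) +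
        B * (1 + (x : ℂ)) ^ (-b) * (₂F₁ (c - a) b (b - a + 1) (u : ℂ) - 1) := by ring
  rw [e]
  have hpa : (1 + x) ^ (-a.re - 1) = (1 + x) ^ (-a.re) * u := by
    rw [sub_eq_add_neg, Real.rpow_add hx1, Real.rpow_neg_one]
  have hpb : (1 + x) ^ (-b.re - 1) = (1 + x) ^ (-b.re) * u := by
    rw [sub_eq_add_neg, Real.rpow_add hx1, Real.rpow_neg_one]
  calc _ ≤ ‖A * (1 + (x : ℂ)) ^ (-a) * (₂F₁ a (c - b) (a - b + 1) (u : ℂ) - 1)‖ +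
        ‖B * (1 + (x : ℂ)) ^ (-b) * (₂F₁ (c - a) b (b - a + 1) (u : ℂ) - 1)‖ := norm_add_le _ _
    _ ≤ ‖A‖ * (1 + x) ^ (-a.re) * (C₃ * u) + ‖B‖ * (1 + x) ^ (-b.re) * (C₄ * u) := by
        rw [norm_mul, norm_mul, norm_mul, norm_mul, norm_one_add_ofReal_cpow_neg a hx1,
          norm_one_add_ofReal_cpow_neg b hx1]
        gcongr
    _ = ‖A‖ * C₃ * ((1 + x) ^ (-a.re) * u) + ‖B‖ * C₄ * ((1 + x) ^ (-b.re) * u) := by ring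
    _ ≤ max (‖A‖ * C₃) (‖B‖ * C₄) * ((1 + x) ^ (-a.re) * u) +
        max (‖A‖ * C₃) (‖B‖ * C₄) * ((1 + x) ^ (-b.re) * u) :=
        add_le_add (mul_le_mul_of_nonneg_right (le_max_left _ _)
          (mul_nonneg (Real.rpow_nonneg hx1.le _) hu0.le))
          (mul_le_mul_of_nonneg_right (le_max_right _ _)
            (mul_nonneg (Real.rpow_nonneg hx1.le _) hu0.le))
    _ = _ := by rw [hpa, hpb]; ring

/-- `IsBigO` form of the two-term asymptotics: `E(a,b;c;−x) − A(1+x)^{−a} − B(1+x)^{−b}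
= O((1+x)^{−Re a−1} + (1+x)^{−Re b−1})` as `x → +∞`. [cite: DLMF, 15.8.2] -/
theorem eulerHypergeometric_neg_ofReal_two_term_isBigO (hb : 0 < b.re) (hbc : b.re < c.re)
    (hab : b - a ≠ 0) (h1 : (b - a).re < 1) (h2 : -1 < (b - a).re) :
    (fun x : ℝ => eulerHypergeometric a b c (-(x : ℂ)) -
        (Gamma c * Gamma (b - a) / (Gamma (c - a) * Gamma b) * (1 + (x : ℂ)) ^ (-a) +
          Gamma c * Gamma (a - b) / (Gamma a * Gamma (c - b)) * (1 + (x : ℂ)) ^ (-b))) =O[atTop]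
      fun x : ℝ => (1 + x) ^ (-a.re - 1) + (1 + x) ^ (-b.re - 1) := by
  obtain ⟨C, -, hC⟩ := eulerHypergeometric_neg_ofReal_two_term hb hbc hab h1 h2
  refine Asymptotics.IsBigO.of_bound C ?_
  filter_upwards [eventually_ge_atTop (1 : ℝ)] with x hx
  have hx1 : (0 : ℝ) < 1 + x := by linarith
  rw [Real.norm_of_nonneg (add_nonneg (Real.rpow_nonneg hx1.le _) (Real.rpow_nonneg hx1.le _))]
  exact hC x hx

/-! ### The same with `x^{−a}, x^{−b}` (`x ≥ 2`) -/

/-- `(1 − w)^{−p} = ₂F₁(p, 1; 1; w)` on `‖w‖ < 1`: the binomial series is hypergeometric.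
[cite: DLMF, 15.4.6] -/
theorem one_sub_cpow_neg_eq_ordinaryHypergeometric (p : ℂ) {w : ℂ} (hw : ‖w‖ < 1) :
    (1 - w) ^ (-p) = ₂F₁ p 1 1 w := by
  refine (hasSum_one_sub_cpow_neg p hw).unique ?_
  simpa only [← binomialCoeff_eq_coeff] using hasSum_coeff_mul_pow (a := p) (b := 1) (c := 1) hw

/-- `‖(1 + 1/x)^{−p} − 1‖ ≤ C/x` for `x ≥ 2` (`(1 + 1/x)^{−p} = ₂F₁(p,1;1;−1/x)`). [folklore] -/
theorem norm_one_add_inv_cpow_neg_sub_one_le (p : ℂ) :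
    ∃ C : ℝ, 0 ≤ C ∧ ∀ x : ℝ, 2 ≤ x → ‖((1 + x⁻¹ : ℝ) : ℂ) ^ (-p) - 1‖ ≤ C * x⁻¹ := by
  obtain ⟨C, hC0, hC⟩ := norm_ordinaryHypergeometric_sub_one_le p 1 1
  refine ⟨C, hC0, fun x hx => ?_⟩
  have hx0 : 0 < x := by linarith
  have hw : ‖(-(x : ℂ)⁻¹)‖ = x⁻¹ := by
    rw [norm_neg, norm_inv, norm_real, Real.norm_eq_abs, abs_of_pos hx0]
  have hw2 : ‖(-(x : ℂ)⁻¹)‖ ≤ 1 / 2 := by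
    rw [hw, ← one_div]; exact one_div_le_one_div_of_le two_pos hx
  rw [show ((1 + x⁻¹ : ℝ) : ℂ) = 1 - -(x : ℂ)⁻¹ by push_cast; ring,
    one_sub_cpow_neg_eq_ordinaryHypergeometric p (by linarith), ← hw]
  exact hC _ hw2

/-- `(1+x)^{p} = x^{p} (1 + 1/x)^{p}` for real `x > 0` (principal powers of positive reals).
[folklore] -/
theorem one_add_ofReal_cpow (p : ℂ) {x : ℝ} (hx : 0 < x) :
    (1 + (x : ℂ)) ^ p = (x : ℂ) ^ p * ((1 + x⁻¹ : ℝ) : ℂ) ^ p := by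
  have hx' : (x : ℂ) ≠ 0 := by exact_mod_cast hx.ne'
  rw [← mul_cpow_ofReal_nonneg hx.le (by positivity)]
  congr 1
  push_cast
  field_simp
  ring

/-- `(1+x)^r ≤ max 1 ((3/2)^r) · x^r` for `x ≥ 2`. [folklore] -/
theorem one_add_rpow_le_mul_rpow {x : ℝ} (hx : 2 ≤ x) (r : ℝ) :
    (1 + x) ^ r ≤ max 1 ((3 / 2 : ℝ) ^ r) * x ^ r := by
  have hx0 : 0 < x := by linarith
  have hix : x⁻¹ ≤ 1 / 2 := by rw [← one_div]; exact one_div_le_one_div_of_le two_pos hx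
  rw [show 1 + x = (1 + x⁻¹) * x by field_simp; ring, Real.mul_rpow (by positivity) hx0.le]
  gcongr
  rcases le_or_gt 0 r with hr | hr
  · exact le_max_of_le_right (Real.rpow_le_rpow (by positivity) (by linarith) hr)
  · exact le_max_of_le_left (Real.rpow_le_one_of_one_le_of_nonpos (by simp [hx0.le]) hr.le)

/-- **DLMF 15.8.2 as two-term asymptotics in the powers `x^{−a}, x^{−b}`**: for
`0 < Re b < Re c`, `b − a ≠ 0`, `|Re(b−a)| < 1` there is `C ≥ 0` with, for all `x ≥ 2`,
`‖E(a,b;c;−x) − (A x^{−a} + B x^{−b})‖ ≤ C(x^{−Re a−1} + x^{−Re b−1})`,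
`A = Γ(c)Γ(b−a)/(Γ(c−a)Γ(b))`, `B = Γ(c)Γ(a−b)/(Γ(a)Γ(c−b))`:
`E(a,b;c;−x) = A x^{−a}(1 + O(1/x)) + B x^{−b}(1 + O(1/x))`. [cite: DLMF, 15.8.2] -/
theorem eulerHypergeometric_neg_ofReal_two_term' (hb : 0 < b.re) (hbc : b.re < c.re)
    (hab : b - a ≠ 0) (h1 : (b - a).re < 1) (h2 : -1 < (b - a).re) :
    ∃ C : ℝ, 0 ≤ C ∧ ∀ x : ℝ, 2 ≤ x →
      ‖eulerHypergeometric a b c (-(x : ℂ)) -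
          (Gamma c * Gamma (b - a) / (Gamma (c - a) * Gamma b) * (x : ℂ) ^ (-a) +
            Gamma c * Gamma (a - b) / (Gamma a * Gamma (c - b)) * (x : ℂ) ^ (-b))‖ ≤
        C * (x ^ (-a.re - 1) + x ^ (-b.re - 1)) := by
  obtain ⟨C₀, hC₀0, hC₀⟩ := eulerHypergeometric_neg_ofReal_two_term hb hbc hab h1 h2
  obtain ⟨Ca, hCa0, hCa⟩ := norm_one_add_inv_cpow_neg_sub_one_le a
  obtain ⟨Cb, hCb0, hCb⟩ := norm_one_add_inv_cpow_neg_sub_one_le b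
  set A : ℂ := Gamma c * Gamma (b - a) / (Gamma (c - a) * Gamma b) with hA
  set B : ℂ := Gamma c * Gamma (a - b) / (Gamma a * Gamma (c - b)) with hB
  set M : ℝ := max (max 1 ((3 / 2 : ℝ) ^ (-a.re - 1))) (max 1 ((3 / 2 : ℝ) ^ (-b.re - 1))) with hM
  have hM0 : 0 ≤ M := le_max_of_le_left (le_max_of_le_left zero_le_one)
  refine ⟨C₀ * M + ‖A‖ * Ca + ‖B‖ * Cb, by positivity, fun x hx => ?_⟩
  have hx0 : 0 < x := by linarith
  have hx1 : (0 : ℝ) < 1 + x := by linarith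
  have hpow : ∀ p : ℂ, (1 + (x : ℂ)) ^ (-p) - (x : ℂ) ^ (-p) =
      (x : ℂ) ^ (-p) * (((1 + x⁻¹ : ℝ) : ℂ) ^ (-p) - 1) := fun p => by
    rw [one_add_ofReal_cpow (-p) hx0]; ring
  have hnorm : ∀ p : ℂ, ‖(x : ℂ) ^ (-p)‖ = x ^ (-p.re) := fun p => by
    rw [norm_cpow_eq_rpow_re_of_pos hx0, neg_re]
  have hr : ∀ q : ℝ, x ^ q * x⁻¹ = x ^ (q - 1) := fun q => by
    rw [sub_eq_add_neg, Real.rpow_add hx0, Real.rpow_neg_one]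
  have e : eulerHypergeometric a b c (-(x : ℂ)) - (A * (x : ℂ) ^ (-a) + B * (x : ℂ) ^ (-b)) =
      (eulerHypergeometric a b c (-(x : ℂ)) -
        (A * (1 + (x : ℂ)) ^ (-a) + B * (1 + (x : ℂ)) ^ (-b))) +
      (A * ((1 + (x : ℂ)) ^ (-a) - (x : ℂ) ^ (-a)) + B * ((1 + (x : ℂ)) ^ (-b) - (x : ℂ) ^ (-b))) := by
    ring
  have hxa := Real.rpow_nonneg hx0.le (-a.re - 1)
  have hxb := Real.rpow_nonneg hx0.le (-b.re - 1)
  have hMa : (1 + x) ^ (-a.re - 1) ≤ M * x ^ (-a.re - 1) :=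
    (one_add_rpow_le_mul_rpow hx _).trans (mul_le_mul_of_nonneg_right (le_max_left _ _) hxa)
  have hMb : (1 + x) ^ (-b.re - 1) ≤ M * x ^ (-b.re - 1) :=
    (one_add_rpow_le_mul_rpow hx _).trans (mul_le_mul_of_nonneg_right (le_max_right _ _) hxb)
  rw [e]
  calc _ ≤ ‖eulerHypergeometric a b c (-(x : ℂ)) -
          (A * (1 + (x : ℂ)) ^ (-a) + B * (1 + (x : ℂ)) ^ (-b))‖ +
        (‖A * ((1 + (x : ℂ)) ^ (-a) - (x : ℂ) ^ (-a))‖ +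
          ‖B * ((1 + (x : ℂ)) ^ (-b) - (x : ℂ) ^ (-b))‖) :=
        (norm_add_le _ _).trans (add_le_add le_rfl (norm_add_le _ _))
    _ ≤ C₀ * ((1 + x) ^ (-a.re - 1) + (1 + x) ^ (-b.re - 1)) +
        (‖A‖ * (x ^ (-a.re) * (Ca * x⁻¹)) + ‖B‖ * (x ^ (-b.re) * (Cb * x⁻¹))) := by
        gcongr
        · exact hC₀ x (by linarith)
        · rw [norm_mul, hpow, norm_mul, hnorm]; gcongr; exact hCa x hx
        · rw [norm_mul, hpow, norm_mul, hnorm]; gcongr; exact hCb x hx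
    _ ≤ C₀ * (M * x ^ (-a.re - 1) + M * x ^ (-b.re - 1)) +
        (‖A‖ * (x ^ (-a.re) * (Ca * x⁻¹)) + ‖B‖ * (x ^ (-b.re) * (Cb * x⁻¹))) := by
        gcongr
    _ = (C₀ * M + ‖A‖ * Ca) * x ^ (-a.re - 1) + (C₀ * M + ‖B‖ * Cb) * x ^ (-b.re - 1) := by
        rw [← hr, ← hr]; ring
    _ ≤ (C₀ * M + ‖A‖ * Ca + ‖B‖ * Cb) * x ^ (-a.re - 1) +
        (C₀ * M + ‖A‖ * Ca + ‖B‖ * Cb) * x ^ (-b.re - 1) :=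
        add_le_add
          (mul_le_mul_of_nonneg_right (by linarith [mul_nonneg (norm_nonneg B) hCb0]) hxa)
          (mul_le_mul_of_nonneg_right (by linarith [mul_nonneg (norm_nonneg A) hCa0]) hxb)
    _ = _ := by ring

end Literature.Analysis.SpecialFunctions.Hypergeometric

end
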